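import Mathlib
import Literature.Combinatorics.Optimization.LPRelaxationsMaxCSP
import Literature.Probability.Moments.HoeffdingCounting
import HarnessLib

/-!
# The CSP matrices `M^{n,𝒫}_{c,s}` have polynomial APPROXIMATE nonnegative rank
# (Chan–Lee–Raghavendra–Steurer 2013/2016, §3.4: the sampling protocol) — PROVED

[ChanEtAl2016, §3.4 (arXiv v3 p. 11)]: "Our main result shows that `M` has superpolynomial
nonnegative rank.  We claim that `M` has only polynomial nonnegative approximate rank … consider the
following communication protocol: Alice receives an instance with value at most `s`, Bob an assignment
`x`; Alice chooses `t` constraints independently at random and sends them to Bob; Bob computes the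
fraction `θ` of the sampled constraints satisfied by `x`; if `θ > c` Bob outputs `0`, else `c − θ`.
This protocol yields a rank-`n^{O(t)}` nonnegative factorisation of a matrix `M'` … `|M'_{G,x} − M_{G,x}|
≤ 2^{−Ω(t)}`" (printed for Max Cut; "since `G(x) ≤ s < c` is bounded away from `c`, we have
`P{θ_{G,x} > c} ≤ 2^{−Ω(t)}`").  Together with the PROVED super-polynomial lower bound on the exact
nonnegative rank (`maxKSat_nnr`, `LpRelaxationsVersusSheraliAdamsProof.lean`) this is the paper's
"first separation between nonnegative rank and smooth nonnegative rank" (§1.1 p. 4), in the tree.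

This file PROVES, for an arbitrary Boolean Max-CSP `𝒫` (vocabulary of `SDPRelaxationsMaxCSP.lean` /
`LPRelaxationsMaxCSP.lean`: `CSPInstance`, `SoundInstances`, `cspMatrix k n 𝒫 c s (ℑ, x) = c − ℑ(x)`,
`HasNonnegFactorization`):

* `ChanEtAl2016_approx_nnr` — for `0 ≤ s < c` and every `t ≥ 1` there is a matrix `M'` with a
  nonnegative factorisation of size `(#constraints)^t = Nat.card (CSPConstraint k n 𝒫)^t` (one column
  per possible message of Alice) such that `0 ≤ M' − M^{n,𝒫}_{c,s} ≤ exp(−t (c − s)²/2)` entrywise.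
  The concentration step is Hoeffding's inequality in the tree's counting form
  (`Literature.Probability.Moments.hoeffding_count_pi`) for the `t` i.i.d. sampled constraints.
* `card_cspConstraint_le` — `#constraints ≤ 2^{2^k} · n^k`, so the size is `≤ (2^{2^k} n^k)^t = n^{O(t)}`.

Theorems only; 0 named facts.
-/

noncomputable section

open Finset

namespace Literature.Combinatorics.Optimization

/-- The constraints of Max-`𝒫` on `n` variables form a finite type (a predicate of `𝒫` and an
injection `[k] ↪ [n]`). [cite: ChanEtAl2016, §2 (arXiv v3 p. 6: "𝒫-constraints")] -/
theorem finite_cspConstraint (k n : ℕ) (P : Set ((Fin k → Bool) → Bool)) :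
    Finite (CSPConstraint k n P) := by
  refine Finite.of_injective (fun C : CSPConstraint k n P => (C.pred, C.idx)) ?_
  intro C D h
  obtain ⟨p, hp, i⟩ := C
  obtain ⟨q, hq, j⟩ := D
  simp only [Prod.mk.injEq] at h
  obtain ⟨rfl, rfl⟩ := h
  rfl

/-- **There are at most `2^{2^k} · n^k` constraints** (at most `2^{2^k}` predicates times at most `n^k`
injections `[k] ↪ [n]`) — the base of the "`n^{O(t)}`" count of messages.
[cite: ChanEtAl2016, §3.4 (arXiv v3 p. 11: "rank_+(M') ≤ n^{O(t)}")] -/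
theorem card_cspConstraint_le (k n : ℕ) (P : Set ((Fin k → Bool) → Bool)) :
    Nat.card (CSPConstraint k n P) ≤ 2 ^ (2 ^ k) * n ^ k := by
  classical
  have hinj : Function.Injective (fun C : CSPConstraint k n P => (C.pred, C.idx)) := by
    intro C D h
    obtain ⟨p, hp, i⟩ := C
    obtain ⟨q, hq, j⟩ := D
    simp only [Prod.mk.injEq] at h
    obtain ⟨rfl, rfl⟩ := h
    rfl
  calc Nat.card (CSPConstraint k n P)
      ≤ Nat.card (((Fin k → Bool) → Bool) × (Fin k ↪ Fin n)) := Nat.card_le_card_of_injective _ hinj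
    _ = 2 ^ (2 ^ k) * (Fintype.card (Fin k ↪ Fin n)) := by
        rw [Nat.card_eq_fintype_card, Fintype.card_prod, Fintype.card_fun, Fintype.card_fun,
          Fintype.card_bool, Fintype.card_fin]
    _ ≤ 2 ^ (2 ^ k) * n ^ k := by
        refine Nat.mul_le_mul_left _ ?_
        rw [Fintype.card_embedding_eq, Fintype.card_fin, Fintype.card_fin]
        exact Nat.descFactorial_le_pow n k

/-- Summing a function of ONE coordinate over all tuples: `Σ_{y : [t] → [M]} g(y_i) = M^{t−1} Σ_a g(a)`,
written as `#([t] → [M]) · Σ_a g(a) = M · Σ_y g(y_i)`. [folklore] -/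
private theorem card_mul_sum_apply {t M : ℕ} (i : Fin t) (g : Fin M → ℝ) :
    (M : ℝ) * ∑ y : Fin t → Fin M, g (y i) =
      (Fintype.card (Fin t → Fin M) : ℝ) * ∑ a : Fin M, g a := by
  classical
  rw [← (Equiv.funSplitAt i (Fin M)).symm.sum_comp (fun y : Fin t → Fin M => g (y i)),
    Fintype.sum_prod_type]
  simp only [Equiv.funSplitAt_symm_apply, dif_pos]
  rw [Fintype.card_congr (Equiv.funSplitAt i (Fin M)), Fintype.card_prod, Fintype.card_fin]
  simp only [sum_const, card_univ, nsmul_eq_mul]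
  rw [← mul_sum]
  push_cast
  ring

/-- **Chan–Lee–Raghavendra–Steurer §3.4: `M^{n,𝒫}_{c,s}` has polynomial approximate nonnegative rank
(the sampling protocol).**  Let `0 ≤ s < c` and `t ≥ 1`.  There is a matrix `M'` on
`Π_n^{≤ s} × {0,1}ⁿ` with a nonnegative factorisation of size `Nat.card (CSPConstraint k n 𝒫)^t` (one
term per message: a `t`-tuple of constraints) such that `0 ≤ M'(ℑ,x) − (c − ℑ(x)) ≤ exp(−t (c − s)²/2)`
for every sound instance `ℑ` and assignment `x` (`M'(ℑ,x) = E max(c − θ, 0)`, `θ` = fraction of `t`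
constraints of `ℑ` sampled uniformly with replacement that `x` satisfies; Hoeffding).
[cite: ChanEtAl2016, §3.4 (arXiv v3 p. 11)] -/
theorem ChanEtAl2016_approx_nnr {k n : ℕ} (P : Set ((Fin k → Bool) → Bool)) {c s : ℝ}
    (hs : 0 ≤ s) (hsc : s < c) {t : ℕ} (ht : 1 ≤ t) :
    ∃ M' : SoundInstances k n P s → (Fin n → Bool) → ℝ,
      HasNonnegFactorization M' (Nat.card (CSPConstraint k n P) ^ t) ∧
      ∀ (I : SoundInstances k n P s) (x : Fin n → Bool),
        0 ≤ M' I x - cspMatrix k n P c s I x ∧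
        M' I x - cspMatrix k n P c s I x ≤ Real.exp (-(t * (c - s) ^ 2 / 2)) := by
  classical
  haveI : Finite (CSPConstraint k n P) := finite_cspConstraint k n P
  letI : Fintype (CSPConstraint k n P) := Fintype.ofFinite _
  have ht0 : (0 : ℝ) < t := by exact_mod_cast ht
  -- Bob's output on a message `σ` (a `t`-tuple of constraints) and assignment `x`
  set outσ : (Fin t → CSPConstraint k n P) → (Fin n → Bool) → ℝ := fun σ x =>
    max (c - (∑ i, if (σ i).sat x then (1 : ℝ) else 0) / t) 0 with houtσ
  have houtσ0 : ∀ σ x, 0 ≤ outσ σ x := fun σ x => le_max_right _ _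
  -- messages indexed by `Fin r`
  set r : ℕ := Nat.card (CSPConstraint k n P) ^ t with hr
  have hcard : Fintype.card (Fin t → CSPConstraint k n P) = r := by
    rw [hr, Fintype.card_fun, Fintype.card_fin, Nat.card_eq_fintype_card]
  let e : (Fin t → CSPConstraint k n P) ≃ Fin r := (Fintype.equivFin _).trans (finCongr hcard)
  -- Alice's message distribution and the matrix `M'`
  set U : SoundInstances k n P s → Fin r → ℝ := fun I l =>
    ((univ.filter fun y : Fin t → Fin I.1.M => (fun i => I.1.cons (y i)) = e.symm l).card : ℝ) /
      Fintype.card (Fin t → Fin I.1.M) with hU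
  set M' : SoundInstances k n P s → (Fin n → Bool) → ℝ := fun I x => ∑ l, U I l * outσ (e.symm l) x
    with hM'
  refine ⟨M', ⟨U, fun l x => outσ (e.symm l) x, fun I l => by positivity, fun l x => houtσ0 _ _,
    fun I x => rfl⟩, fun I x => ?_⟩
  -- from now on fix a sound instance `ℑ` and an assignment `x`
  set Mn : ℕ := I.1.M with hMn
  have hMn0 : 0 < Mn := I.1.M_pos
  have hMnR : (0 : ℝ) < Mn := by exact_mod_cast hMn0
  haveI : Nonempty (Fin Mn) := ⟨⟨0, hMn0⟩⟩
  set N : ℝ := (Fintype.card (Fin t → Fin Mn) : ℝ) with hN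
  have hN0 : 0 < N := by rw [hN]; exact_mod_cast Fintype.card_pos
  have hNpow : N = (Mn : ℝ) ^ t := by
    rw [hN, Fintype.card_fun, Fintype.card_fin, Fintype.card_fin, Nat.cast_pow]
  -- the satisfied-indicator of constraint `a` and the sample sum
  set sat1 : Fin Mn → ℝ := fun a => if (I.1.cons a).sat x then 1 else 0 with hsat1
  have hsat01 : ∀ a, 0 ≤ sat1 a ∧ sat1 a ≤ 1 := fun a => by
    simp only [hsat1]; split_ifs <;> norm_num
  have hval : I.1.val x = (∑ a, sat1 a) / Mn := rfl
  have hvx : I.1.val x ≤ s := I.2 x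
  have hv0 : 0 ≤ I.1.val x := I.1.val_nonneg x
  set S : (Fin t → Fin Mn) → ℝ := fun y => ∑ i, sat1 (y i) with hS
  have hS01 : ∀ y, 0 ≤ S y ∧ S y ≤ t := by
    intro y
    constructor
    · exact sum_nonneg fun i _ => (hsat01 _).1
    · calc S y ≤ ∑ _i : Fin t, (1 : ℝ) := sum_le_sum fun i _ => (hsat01 _).2
        _ = t := by simp
  -- `M'(ℑ,x) = N⁻¹ Σ_y max(c − S(y)/t, 0)`
  have hout_y : ∀ y : Fin t → Fin Mn, outσ (fun i => I.1.cons (y i)) x = max (c - S y / t) 0 := by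
    intro y; simp only [houtσ, hS, hsat1]
  have hM'eq : M' I x = (∑ y : Fin t → Fin Mn, max (c - S y / t) 0) / N := by
    have h1 : M' I x = ∑ σ : Fin t → CSPConstraint k n P,
        ((univ.filter fun y : Fin t → Fin Mn => (fun i => I.1.cons (y i)) = σ).card : ℝ) / N *
          outσ σ x := by
      rw [hM']
      exact (e.symm.sum_comp (fun σ => ((univ.filter fun y : Fin t → Fin Mn =>
        (fun i => I.1.cons (y i)) = σ).card : ℝ) / N * outσ σ x))
    rw [h1, sum_div]
    have h2 : ∑ y : Fin t → Fin Mn, max (c - S y / t) 0 / N =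
        ∑ σ : Fin t → CSPConstraint k n P, ∑ y ∈ univ.filter
          (fun y : Fin t → Fin Mn => (fun i => I.1.cons (y i)) = σ), max (c - S y / t) 0 / N := by
      rw [sum_fiberwise univ (fun y : Fin t → Fin Mn => fun i => I.1.cons (y i))]
    rw [h2]
    refine sum_congr rfl fun σ _ => ?_
    rw [sum_congr rfl fun y hy => by rw [← hout_y y, (mem_filter.1 hy).2], sum_const, nsmul_eq_mul]
    ring
  -- `Σ_y (c − S(y)/t) = N (c − ℑ(x))` (each sampled constraint is uniform)
  have hmean : ∑ y : Fin t → Fin Mn, (c - S y / t) = N * (c - I.1.val x) := by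
    have hSy : ∑ y : Fin t → Fin Mn, S y = N * t * I.1.val x := by
      rw [hS, sum_comm]
      have : ∀ i : Fin t, ∑ y : Fin t → Fin Mn, sat1 (y i) = N * I.1.val x := by
        intro i
        have h := card_mul_sum_apply i sat1
        rw [← hN] at h
        rw [hval]
        field_simp
        linarith
      rw [sum_congr rfl fun i _ => this i, sum_const, card_univ, Fintype.card_fin, nsmul_eq_mul]
      ring
    rw [sum_sub_distrib, sum_const, card_univ, ← sum_div, hSy, nsmul_eq_mul, ← hN]
    field_simp
  -- the deviation `M' − M = N⁻¹ Σ_y (max(c − θ,0) − (c − θ)) ∈ [0, P(θ ≥ c)]`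
  have hdev : M' I x - cspMatrix k n P c s I x =
      (∑ y : Fin t → Fin Mn, (max (c - S y / t) 0 - (c - S y / t))) / N := by
    rw [hM'eq, cspMatrix, sum_sub_distrib, hmean]
    field_simp
  have hterm0 : ∀ y : Fin t → Fin Mn, 0 ≤ max (c - S y / t) 0 - (c - S y / t) := fun y => by
    linarith [le_max_left (c - S y / t) 0]
  have hterm1 : ∀ y : Fin t → Fin Mn, max (c - S y / t) 0 - (c - S y / t) ≤
      if c ≤ S y / t then 1 else 0 := by
    intro y
    split_ifs with h
    · rw [max_eq_right (by linarith)]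
      have : S y / t ≤ 1 := by rw [div_le_one ht0]; exact (hS01 y).2
      linarith
    · rw [max_eq_left (by linarith)]; linarith
  constructor
  · rw [hdev]; exact div_nonneg (sum_nonneg fun y _ => hterm0 y) hN0.le
  -- Hoeffding for the count of `{y : θ(y) ≥ c}`
  have hcount : ((univ.filter fun y : Fin t → Fin Mn => c ≤ S y / t).card : ℝ) ≤
      Real.exp (-(t * (c - s) ^ 2 / 2)) * N := by
    set f : Fin Mn → ℝ := fun a => sat1 a - I.1.val x with hf
    have hf0 : ∀ _i : Fin t, ∑ a, f a = 0 := by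
      intro i
      rw [hf, sum_sub_distrib, sum_const, card_univ, Fintype.card_fin, nsmul_eq_mul, hval]
      field_simp
      ring
    have hfc : ∀ (_i : Fin t) (a : Fin Mn), |f a| ≤ 1 := by
      intro i a
      rw [abs_le]
      have := hsat01 a
      have hv1 : I.1.val x ≤ 1 := I.1.val_le_one x
      constructor <;> simp only [hf] <;> linarith
    have hτ : 0 ≤ (t : ℝ) * (c - s) := by positivity
    have hsum1 : (0 : ℝ) < ∑ _i : Fin t, (1 : ℝ) ^ 2 := by simp; positivity
    have h := Literature.Probability.Moments.hoeffding_count_pi (fun (_ : Fin t) a => f a)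
      (fun _ => (1 : ℝ)) hf0 hfc hτ hsum1
    have hincl : (univ.filter fun y : Fin t → Fin Mn => c ≤ S y / t) ⊆
        (univ.filter fun y : Fin t → Fin Mn => (t : ℝ) * (c - s) ≤ ∑ i, f (y i)) := by
      intro y hy
      rw [mem_filter] at hy ⊢
      refine ⟨mem_univ _, ?_⟩
      have h1 : (t : ℝ) * c ≤ S y := by
        have := hy.2; rwa [le_div_iff₀ ht0, mul_comm] at this
      simp only [hf, sum_sub_distrib, sum_const, card_univ, Fintype.card_fin, nsmul_eq_mul]
      rw [hS] at h1
      nlinarith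
    have hexp : Real.exp (-(((t : ℝ) * (c - s)) ^ 2 / (2 * ∑ _i : Fin t, (1 : ℝ) ^ 2))) =
        Real.exp (-(t * (c - s) ^ 2 / 2)) := by
      congr 1
      simp only [one_pow, sum_const, card_univ, Fintype.card_fin, nsmul_eq_mul, mul_one]
      field_simp
    have hprod : (∏ _i : Fin t, (Fintype.card (Fin Mn) : ℝ)) = N := by
      rw [prod_const, card_univ, Fintype.card_fin, Fintype.card_fin, hNpow]
    calc ((univ.filter fun y : Fin t → Fin Mn => c ≤ S y / t).card : ℝ)
        ≤ ((univ.filter fun y : Fin t → Fin Mn => (t : ℝ) * (c - s) ≤ ∑ i, f (y i)).card : ℝ) := by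
          exact_mod_cast card_le_card hincl
      _ ≤ _ := h
      _ = Real.exp (-(t * (c - s) ^ 2 / 2)) * N := by rw [hexp, hprod]
  rw [hdev, div_le_iff₀ hN0]
  calc ∑ y : Fin t → Fin Mn, (max (c - S y / t) 0 - (c - S y / t))
      ≤ ∑ y : Fin t → Fin Mn, (if c ≤ S y / t then (1 : ℝ) else 0) := sum_le_sum fun y _ => hterm1 y
    _ = ((univ.filter fun y : Fin t → Fin Mn => c ≤ S y / t).card : ℝ) := by
        rw [← sum_boole]
    _ ≤ Real.exp (-(t * (c - s) ^ 2 / 2)) * N := hcount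

end Literature.Combinatorics.Optimization

end
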